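import Literature.AnabelianGeometry.EtaleTheta.ContH1CyclicExtensionFinite
import HarnessLib

/-!
# Continuous `H¹`: extending an invariant class along a CYCLIC quotient, III — class-level form
# (support file for [EtTh] §1–§2)

Sequel of `ContH1CyclicExtension.lean` / `ContH1CyclicExtensionFinite.lean`: the same results stated for
CLASSES, i.e. for the groups `ContH1 φ A N`, `ContH1 φ A H` and the maps `ContH1.res` (restriction) and
`ContH1.conj` (the conjugation action of `G` on `H¹(N, A)`, `N` normal in `G`) of `ContH1.lean`:
for `N ≤ H ≤ G`, `N` open and normal, `H/N` cyclic generated by `t` — infinite cyclic, or of order `m` with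
`x ↦ x^m` bijective on `A` — every class of `H¹(N, A)` FIXED by `t` is the RESTRICTION of a class of
`H¹(H, A)`: exactness of `H¹(H, A) → H¹(N, A)^{H/N} → H²(H/N, A^N)` with vanishing `H²`
[cite: NeukirchSchmidtWingberg2008, I §6 Prop 1.6.7].  Classical; no anabelian content; nothing of [EtTh]
is asserted.  Seat abc-iut-w5-d234 (wave-5 prover), for the L2 residual "x1" named by abc-iut-L2-t7.
-/

namespace Literature.AnabelianGeometry.EtaleTheta

namespace ContH1

open scoped IsMulCommutative

variable {G G' : Type*} [Group G] [TopologicalSpace G] [IsTopologicalGroup G]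
  [Group G'] [TopologicalSpace G'] [IsTopologicalGroup G']
  {φ : G →* G'} {A : Subgroup G'} [A.Normal] [IsMulCommutative A]
  {N H : Subgroup G}

/-! ### Class-level form: restriction `H¹(H, A) → H¹(N, A)` is ONTO the `t`-invariant classes -/

section Classes

variable [N.Normal]

/-- Unpacking `t·[f] = [f]` in `H¹(N, A)` (`ContH1.conj`): a witness `b` of the `t`-invariance identity
`f(t n t⁻¹) = b · ᵗf(n) · (ᵗⁿᵗ⁻¹b)⁻¹` (namely `b = a⁻¹` for `f = (t·f)·∂a`). [cite: NeukirchSchmidtWingberg2008, I §6 Prop 1.6.7] -/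
theorem exists_witness_of_conj_eq {t : G} (f : contCocycles φ A N)
    (hx : ContH1.conj φ A t (QuotientGroup.mk f : ContH1 φ A N) = QuotientGroup.mk f) :
    ∃ b : ↥A, ∀ (n : G) (hn : n ∈ N) (htn : t * n * t⁻¹ ∈ N), f.1 ⟨t * n * t⁻¹, htn⟩ =
      b * MulAut.conjNormal (φ t) (f.1 ⟨n, hn⟩) * (MulAut.conjNormal (φ (t * n * t⁻¹)) b)⁻¹ := by
  have hx' : (QuotientGroup.mk (conjCocycle φ A t f) : ContH1 φ A N) = QuotientGroup.mk f := hx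
  rw [QuotientGroup.eq, Subgroup.mem_subgroupOf, mem_contCoboundaries_iff] at hx'
  obtain ⟨a, ha⟩ := hx'
  refine ⟨a⁻¹, fun n hn htn => ?_⟩
  have h1 := congrFun ha ⟨t * n * t⁻¹, htn⟩
  change ((conjCocycle φ A t f).1 ⟨t * n * t⁻¹, htn⟩)⁻¹ * f.1 ⟨t * n * t⁻¹, htn⟩ = _ at h1
  have h2 : (conjCocycle φ A t f).1 ⟨t * n * t⁻¹, htn⟩ = MulAut.conjNormal (φ t) (f.1 ⟨n, hn⟩) := by
    have e : MulAut.conjNormal t⁻¹ (⟨t * n * t⁻¹, htn⟩ : ↥N) = ⟨n, hn⟩ := by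
      apply Subtype.ext
      rw [MulAut.conjNormal_apply, inv_inv]
      group
    change MulAut.conjNormal (φ t) (f.1 (MulAut.conjNormal t⁻¹ ⟨t * n * t⁻¹, htn⟩)) = _
    rw [e]
  rw [h2, inv_mul_eq_iff_eq_mul] at h1
  rw [h1, map_inv]
  refine Additive.ofMul.injective ?_
  simp only [ofMul_mul, ofMul_inv]
  abel

/-- **`H/N ≅ ℤ`: restriction `H¹(H, A) → H¹(N, A)` is onto the `t`-invariant classes** — every class of
`H¹(N, A)` fixed by the generator `t` of `H/N` is the restriction of a class of `H¹(H, A)` (exactness of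
`H¹(H, A) → H¹(N, A)^{H/N} → H²(H/N, A^N) = 0`). [cite: NeukirchSchmidtWingberg2008, I §6 Prop 1.6.7] -/
theorem exists_res_eq_of_conj_eq_of_int (hφ : Continuous φ) (hNopen : IsOpen (N : Set G))
    (hNH : N ≤ H) (χ : ↥H →* Multiplicative ℤ) (hker : ∀ h : ↥H, χ h = 1 ↔ (h : G) ∈ N)
    {t : G} (ht : t ∈ H) (hχt : χ ⟨t, ht⟩ = Multiplicative.ofAdd 1)
    (x : ContH1 φ A N) (hx : ContH1.conj φ A t x = x) :
    ∃ y : ContH1 φ A H, ContH1.res φ A hNH y = x := by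
  induction x using QuotientGroup.induction_on with
  | H f =>
    obtain ⟨b, hinv⟩ := exists_witness_of_conj_eq f hx
    obtain ⟨F, hFN, -⟩ := exists_contCocycle_extension_of_int hφ hNopen hNH χ hker ht hχt f b hinv
    refine ⟨QuotientGroup.mk F, ?_⟩
    change (QuotientGroup.mk (resCocycle φ A hNH F) : ContH1 φ A N) = QuotientGroup.mk f
    congr 1
    exact Subtype.ext (funext fun n => hFN n)

/-- **`H/N ≅ ℤ/m` with `x ↦ x^m` bijective on `A`: restriction `H¹(H, A) → H¹(N, A)` is onto the
`t`-invariant classes** (`H²(ℤ/m, A^N) = 0`). [cite: NeukirchSchmidtWingberg2008, I §6 Prop 1.6.7] -/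
theorem exists_res_eq_of_conj_eq_of_zmod (hφ : Continuous φ) (hNopen : IsOpen (N : Set G))
    (hNH : N ≤ H) {m : ℕ} [NeZero m] (χ : ↥H →* Multiplicative (ZMod m))
    (hker : ∀ h : ↥H, χ h = 1 ↔ (h : G) ∈ N)
    {t : G} (ht : t ∈ H) (hχt : χ ⟨t, ht⟩ = Multiplicative.ofAdd 1)
    (hpow : Function.Bijective fun a : ↥A => a ^ m)
    (x : ContH1 φ A N) (hx : ContH1.conj φ A t x = x) :
    ∃ y : ContH1 φ A H, ContH1.res φ A hNH y = x := by
  induction x using QuotientGroup.induction_on with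
  | H f =>
    obtain ⟨b, hinv⟩ := exists_witness_of_conj_eq f hx
    obtain ⟨F, hFN, -⟩ :=
      exists_contCocycle_extension_of_zmod_of_powBijective hφ hNopen hNH χ hker ht hχt f b hinv hpow
    refine ⟨QuotientGroup.mk F, ?_⟩
    change (QuotientGroup.mk (resCocycle φ A hNH F) : ContH1 φ A N) = QuotientGroup.mk f
    congr 1
    exact Subtype.ext (funext fun n => hFN n)

end Classes

/-! ### Uniqueness in index two, and the two-step extension (index `2`, then `ℤ`) -/

section TwoStep

omit [IsTopologicalGroup G] in
/-- The principal crossed homomorphism `h ↦ ʰa · a⁻¹` of `a ∈ A` is a continuous cocycle on any `H ≤ G`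
(`φ` continuous). [cite: NeukirchSchmidtWingberg2008, I §2 and II §7] -/
theorem principal_mem_contCocycles (hφ : Continuous φ) (a : ↥A) (H : Subgroup G) :
    (fun h : ↥H => MulAut.conjNormal (φ (h : G)) a * a⁻¹) ∈ contCocycles φ A H := by
  refine ⟨?_, fun g h => ?_⟩
  · have hc : Continuous fun h : ↥H => (MulAut.conjNormal (φ (h : G)) a : ↥A) :=
      continuous_induced_rng.2 (by
        simp only [Function.comp_def, MulAut.conjNormal_apply]
        fun_prop)
    exact hc.mul continuous_const
  · simp only [Subgroup.coe_mul, map_mul, MulAut.mul_apply, map_inv]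
    refine Additive.ofMul.injective ?_
    simp only [ofMul_mul, ofMul_inv]
    abel

omit [IsTopologicalGroup G] in
/-- **Index two, uniqueness** (`H¹(ℤ/2, A^N) = 0` when squaring is bijective on `A`): for `N ≤ H` with
`H = N ⊔ N·t`, a cocycle `Q` on `H` that is TRIVIAL on `N` is a coboundary.  Hence two extensions to `H` of
the same cocycle on `N` are cohomologous — the extension class of
`exists_contCocycle_extension_of_index_two` is unique. [cite: NeukirchSchmidtWingberg2008, I §6 Prop 1.6.7] -/
theorem exists_eq_principal_of_res_eq_one_of_index_two (hNH : N ≤ H) {t : G} (ht : t ∈ H)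
    (htN : t ∉ N) (h2 : ∀ h ∈ H, h ∉ N → h * t⁻¹ ∈ N) (hpow : Function.Bijective fun a : ↥A => a ^ 2)
    (Q : contCocycles φ A H) (hQ : ∀ n : ↥N, Q.1 ⟨n, hNH n.2⟩ = 1) :
    ∃ e : ↥A, ∀ h : ↥H, Q.1 h = MulAut.conjNormal (φ (h : G)) e * e⁻¹ := by
  -- normality of `N` in `H`, `t² ∈ N`, `t⁻¹ n t ∈ N`
  have hconj : ∀ n ∈ N, t * n * t⁻¹ ∈ N := fun n hn =>
    h2 (t * n) (H.mul_mem ht (hNH hn)) (fun htn => htN (by simpa using N.mul_mem htn (N.inv_mem hn)))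
  have ht2 : t * t ∈ N := by
    have h := h2 t⁻¹ (H.inv_mem ht) (fun h' => htN (by simpa using N.inv_mem h'))
    simpa using N.inv_mem h
  have hconj' : ∀ n ∈ N, t⁻¹ * n * t ∈ N := by
    intro n hn
    have e : t⁻¹ * n * t = (t * t)⁻¹ * (t * n * t⁻¹) * (t * t) := by group
    rw [e]
    exact N.mul_mem (N.mul_mem (N.inv_mem ht2) (hconj n hn)) ht2
  set a : ↥A := Q.1 ⟨t, ht⟩ with ha
  -- `a` is fixed by `N` and inverted by `t`
  have haN : ∀ n ∈ N, MulAut.conjNormal (φ n) a = a := by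
    intro n hn
    have e1 : (⟨n * t, H.mul_mem (hNH hn) ht⟩ : ↥H) = ⟨n, hNH hn⟩ * ⟨t, ht⟩ := rfl
    have e2 : (⟨n * t, H.mul_mem (hNH hn) ht⟩ : ↥H) = ⟨t, ht⟩ * ⟨t⁻¹ * n * t, hNH (hconj' n hn)⟩ :=
      Subtype.ext (by simp only [Subgroup.coe_mul]; group)
    have h1 : Q.1 ⟨n * t, H.mul_mem (hNH hn) ht⟩ = MulAut.conjNormal (φ n) a := by
      rw [e1, Q.2.2, hQ ⟨n, hn⟩, one_mul]
    have h2' : Q.1 ⟨n * t, H.mul_mem (hNH hn) ht⟩ = a := by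
      rw [e2, Q.2.2, hQ ⟨_, hconj' n hn⟩, map_one, mul_one]
    rw [← h1, h2']
  have hta : MulAut.conjNormal (φ t) a = a⁻¹ := by
    have e1 : (⟨t * t, H.mul_mem ht ht⟩ : ↥H) = ⟨t, ht⟩ * ⟨t, ht⟩ := rfl
    have h1 : Q.1 ⟨t * t, H.mul_mem ht ht⟩ = a * MulAut.conjNormal (φ t) a := by rw [e1, Q.2.2]
    rw [hQ ⟨_, ht2⟩] at h1
    exact eq_inv_of_mul_eq_one_right h1.symm
  -- a square root `c` of `a`: fixed by `N`, inverted by `t`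
  obtain ⟨c, hc⟩ := hpow.2 a
  simp only at hc
  have hcN : ∀ n ∈ N, MulAut.conjNormal (φ n) c = c := by
    intro n hn
    apply hpow.1
    simp only
    rw [← map_pow, hc, haN n hn]
  have hct : MulAut.conjNormal (φ t) c = c⁻¹ := by
    apply hpow.1
    simp only
    rw [← map_pow, hc, hta, inv_pow, hc]
  refine ⟨c⁻¹, fun h => ?_⟩
  by_cases hh : (h : G) ∈ N
  · rw [show h = ⟨(h : G), hNH hh⟩ from rfl, hQ ⟨h, hh⟩, map_inv, hcN _ hh, mul_inv_cancel]
  · have hn : (h : G) * t⁻¹ ∈ N := h2 _ h.2 hh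
    have hQh : Q.1 h = a := by
      have e1 : h = ⟨(h : G) * t⁻¹, hNH hn⟩ * ⟨t, ht⟩ := Subtype.ext (by simp)
      conv_lhs => rw [e1]
      rw [Q.2.2, hQ ⟨_, hn⟩, one_mul]
      exact haN _ hn
    have hhc : MulAut.conjNormal (φ (h : G)) c = c⁻¹ := by
      have e2 : (h : G) = (h : G) * t⁻¹ * t := by group
      rw [e2, map_mul φ, MonoidHom.map_mul MulAut.conjNormal, MulAut.mul_apply, hct, map_inv,
        hcN _ hn]
    rw [hQh, map_inv, hhc, inv_inv, ← hc, pow_two]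

variable {N₂ N₁ : Subgroup G} [N₂.Normal] [N₁.Normal]

/-- **Two-step extension: index `2`, then infinite cyclic** — the [EtTh] §2 shape
`Π^tp_{Ÿ} = Π^tp_{Y₂} ≤ Π^tp_Y ≤ Π^tp_X̲` (`K = K̈`).  Let `N₂ ≤ N₁ ≤ H ≤ G` with `N₂, N₁` open and normal in
`G`, `N₁ = N₂ ⊔ N₂·t₁` (index two), `χ : H → ℤ` a character with kernel `N₁` and `χ(t) = 1`, and let
squaring be bijective on `A`.  If the class of a cocycle `f` on `N₂` is invariant under BOTH `t₁` and `t`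
(witnesses `b₁`, `b`), then `f` extends to a continuous cocycle on `H`.  (Step 1:
`exists_contCocycle_extension_of_index_two`; the extension class on `N₁` is unique by
`exists_eq_principal_of_res_eq_one_of_index_two`, hence again `t`-invariant; Step 2:
`exists_contCocycle_extension_of_int`.) [cite: NeukirchSchmidtWingberg2008, I §6 Prop 1.6.7] -/
theorem exists_contCocycle_extension_two_step (hφ : Continuous φ) (hN₂open : IsOpen (N₂ : Set G))
    (hN₁open : IsOpen (N₁ : Set G)) (h₂₁ : N₂ ≤ N₁) (h₁H : N₁ ≤ H)
    {t₁ : G} (ht₁ : t₁ ∈ N₁) (ht₁N : t₁ ∉ N₂) (h2 : ∀ h ∈ N₁, h ∉ N₂ → h * t₁⁻¹ ∈ N₂)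
    (χ : ↥H →* Multiplicative ℤ) (hker : ∀ h : ↥H, χ h = 1 ↔ (h : G) ∈ N₁)
    {t : G} (ht : t ∈ H) (hχt : χ ⟨t, ht⟩ = Multiplicative.ofAdd 1)
    (hpow : Function.Bijective fun a : ↥A => a ^ 2)
    (f : contCocycles φ A N₂) (b₁ b : ↥A)
    (hinv₁ : ∀ (n : G) (hn : n ∈ N₂) (htn : t₁ * n * t₁⁻¹ ∈ N₂), f.1 ⟨t₁ * n * t₁⁻¹, htn⟩ =
      b₁ * MulAut.conjNormal (φ t₁) (f.1 ⟨n, hn⟩) * (MulAut.conjNormal (φ (t₁ * n * t₁⁻¹)) b₁)⁻¹)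
    (hinv : ∀ (n : G) (hn : n ∈ N₂) (htn : t * n * t⁻¹ ∈ N₂), f.1 ⟨t * n * t⁻¹, htn⟩ =
      b * MulAut.conjNormal (φ t) (f.1 ⟨n, hn⟩) * (MulAut.conjNormal (φ (t * n * t⁻¹)) b)⁻¹) :
    ∃ F : contCocycles φ A H, ∀ n : ↥N₂, F.1 ⟨n, h₁H (h₂₁ n.2)⟩ = f.1 n := by
  -- Step 1: extend to `N₁`
  obtain ⟨F₁, hF₁N, -⟩ :=
    exists_contCocycle_extension_of_index_two hφ hN₂open h₂₁ ht₁ ht₁N h2 f b₁ hinv₁ hpow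
  -- the `t`-conjugate of `F₁` versus `F₁ · ∂b`: trivial on `N₂`
  set g := conjCocycle φ A t F₁ with hg
  set P : contCocycles φ A N₁ := ⟨_, principal_mem_contCocycles hφ b N₁⟩ with hP
  set Q : contCocycles φ A N₁ := g * (F₁ * P)⁻¹ with hQ
  have hQN : ∀ n : ↥N₂, Q.1 ⟨n, h₂₁ n.2⟩ = 1 := by
    intro n
    have hm : t⁻¹ * n * t ∈ N₂ := by
      have := Subgroup.Normal.conj_mem inferInstance (n : G) n.2 t⁻¹
      simpa using this
    have htm : t * (t⁻¹ * n * t) * t⁻¹ ∈ N₂ := by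
      have e : t * (t⁻¹ * n * t) * t⁻¹ = n := by group
      rw [e]; exact n.2
    have hg1 : g.1 ⟨n, h₂₁ n.2⟩ = MulAut.conjNormal (φ t) (f.1 ⟨t⁻¹ * n * t, hm⟩) := by
      rw [hg]
      change MulAut.conjNormal (φ t) (F₁.1 (MulAut.conjNormal t⁻¹ ⟨n, h₂₁ n.2⟩)) = _
      have e : MulAut.conjNormal t⁻¹ (⟨(n : G), h₂₁ n.2⟩ : ↥N₁) = ⟨t⁻¹ * n * t, h₂₁ hm⟩ :=
        Subtype.ext (by rw [MulAut.conjNormal_apply, inv_inv])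
      rw [e, hF₁N ⟨_, hm⟩]
    have hf1 : f.1 n = b * MulAut.conjNormal (φ t) (f.1 ⟨t⁻¹ * n * t, hm⟩) *
        (MulAut.conjNormal (φ n) b)⁻¹ := by
      have h1 := hinv (t⁻¹ * n * t) hm htm
      have e : (⟨t * (t⁻¹ * n * t) * t⁻¹, htm⟩ : ↥N₂) = n := Subtype.ext (by simp only; group)
      rw [e] at h1
      rw [h1]
      congr 3
      group
    have hval : Q.1 ⟨n, h₂₁ n.2⟩ = g.1 ⟨n, h₂₁ n.2⟩ * (F₁.1 ⟨n, h₂₁ n.2⟩ *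
        (MulAut.conjNormal (φ (n : G)) b * b⁻¹))⁻¹ := rfl
    rw [hval, hg1, hF₁N n, hf1]
    refine Additive.ofMul.injective ?_
    simp only [ofMul_mul, ofMul_inv, ofMul_one]
    abel
  -- so `Q = ∂e` on `N₁` (uniqueness in index two)
  obtain ⟨e, he⟩ := exists_eq_principal_of_res_eq_one_of_index_two h₂₁ ht₁ ht₁N h2 hpow Q hQN
  -- whence the `t`-invariance identity for `F₁` with witness `b·e`
  have hinv' : ∀ (n : G) (hn : n ∈ N₁) (htn : t * n * t⁻¹ ∈ N₁), F₁.1 ⟨t * n * t⁻¹, htn⟩ =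
      b * e * MulAut.conjNormal (φ t) (F₁.1 ⟨n, hn⟩) *
        (MulAut.conjNormal (φ (t * n * t⁻¹)) (b * e))⁻¹ := by
    intro n hn htn
    have h1 := he ⟨t * n * t⁻¹, htn⟩
    have hval : Q.1 ⟨t * n * t⁻¹, htn⟩ = g.1 ⟨t * n * t⁻¹, htn⟩ * (F₁.1 ⟨t * n * t⁻¹, htn⟩ *
        (MulAut.conjNormal (φ (t * n * t⁻¹)) b * b⁻¹))⁻¹ := rfl
    have hg1 : g.1 ⟨t * n * t⁻¹, htn⟩ = MulAut.conjNormal (φ t) (F₁.1 ⟨n, hn⟩) := by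
      rw [hg]
      change MulAut.conjNormal (φ t) (F₁.1 (MulAut.conjNormal t⁻¹ ⟨t * n * t⁻¹, htn⟩)) = _
      have e' : MulAut.conjNormal t⁻¹ (⟨t * n * t⁻¹, htn⟩ : ↥N₁) = ⟨n, hn⟩ := by
        apply Subtype.ext
        rw [MulAut.conjNormal_apply, inv_inv]
        group
      rw [e']
    rw [hval, hg1] at h1
    -- `h1 : ᵗF₁(n) · (F₁(tnt⁻¹) · (ᵗⁿᵗ⁻¹b · b⁻¹))⁻¹ = ᵗⁿᵗ⁻¹e · e⁻¹`
    rw [mul_inv_eq_iff_eq_mul] at h1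
    -- solve for `F₁(tnt⁻¹)` in the commutative group `A`
    rw [h1, _root_.map_mul (MulAut.conjNormal (φ (t * n * t⁻¹))) b e]
    refine Additive.ofMul.injective ?_
    simp only [ofMul_mul, ofMul_inv]
    abel
  -- Step 2: extend to `H`
  obtain ⟨F, hFN, -⟩ := exists_contCocycle_extension_of_int hφ hN₁open h₁H χ hker ht hχt F₁ (b * e) hinv'
  exact ⟨F, fun n => (hFN ⟨n, h₂₁ n.2⟩).trans (hF₁N n)⟩

end TwoStep

end ContH1

end Literature.AnabelianGeometry.EtaleTheta
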